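/-
Origin: expansion seat `planner-pub-hodgecm-mc-axioms-1-g14-0`, handover #W248 2026-08-20T15:53:55Z md5 81d481d88fc5 (PKG 43173f027693 → 81d481d88fc5; 172 l.; MECHANICAL (iib-R) rewrite v3.1 of the PKG file as it stands (40 token edits; rules R1x1+RX[h₂']x39)) (`HOME/mc/pub-hodgecm-mc-axioms-1-g14/revendor/kit-r55/stage55/HodgeCM/Model/Binders/ArchKTypeHolType.lean`, md5 81d481d88fc5, 172 lines);
landed by the gen-22 packager (p-g22) in gate run 55 REPLACES the earlier landed copy of `HodgeCM/Model/Binders/ArchKTypeHolType.lean` (seat copy carried the packager Origin header of an earlier run (stripped)).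
-/
/-
# `IsHolType` and `adm₃₄` of the product situation of an archimedean `K`-type datum, at EVERY `k`

Binder-1 (rows 14/15 `gen12`/`real34`, node B2-meet) — generation 11.

The row-15 admissibility predicate `adm₃₄ … Γ k Sit` (`ThetaGenExports`) is the conjunction
`Sit.IsSaturated (KΓ Γ) ∧ Sit.IsStrict ∧ IsHolType … Γ k Sit weightFunctions`.  For the product situation
`B.toProduct.situation` of an ARCHIMEDEAN `K`-type datum `B : ArchKTypeData (thetaSpaceInputIn … S h) k N`
(`ArchKType`), the first two conjuncts are the installed `situation_isSaturated` / `situation_isStrict`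
(`SupplySituation`).  This leaf supplies the third, for EVERY `k : Fin 4`, from exactly the three one-sided
hypotheses E already carries for `k = 0, 1` (rows `hT` (H1), `hpd` (AN), `hk` (REP) along `-i e_p`):

* `ArchKTypeData.isHolGerm_thetaFormOf_of_isWeaklyCR` — the adelic theta form `B.toProduct.thetaFormOf f` of the
  one test family has holomorphic germs along `ιinf B.Γ₀` at EVERY adelic base point `y` (theta-3's
  `differentiableAt_apply_thetaFormOf` is already stated at an arbitrary `y : G_U(𝔸)`; componentwise assembly by
  `ThetaHolAssembly.differentiableAt_and_fderiv_I_smul_pi` — the `key` of `ArchKTypeData.hol_of_isWeaklyCR`, kept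
  as a conclusion instead of being spent on the archimedean restriction);
* `ArchKTypeData.isHolType_of_isWeaklyCR` — `IsHolType … B.Γ₀ k B.toProduct.situation 𝓕` for every `𝓕`
  (`isHolType_of_generators` on `situation_𝓙 = {jFam}`; the generator IS `B.toProduct.thetaFormOf f`, `rfl`);
* `ArchKTypeData.adm₃₄_of_isWeaklyCR` and the two `𝔭₋`-shaped corollaries `adm₃₄_of_isPMinusKilled`,
  `adm₃₄_of_isPMinusKilledAlong` (the latter in the exact shape of E's rows `hpd`/`hk`);
* `ArchKTypeData.toThetaTop_frame` — the frame equation of `admWedgeSet` for the frame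
  `a ↦ B.toProduct.Φfam (proj a)` of the one family (`rfl`), and `ArchKTypeData.exists_adm₃₄_frame_of_isPMinusKilledAlong`,
  the packaged existential `∃ Sit j, (adm₃₄ … B.Γ₀ k Sit ∧ j ∈ Sit.𝓙) ∧ ∀ a, toThetaTop (frame a) = j (Sit.ι (proj a))`
  consumed (at `k = 2, 3`, common level) by `Binders.Real34WedgeSpan.wedge_mem_admWedgeSpan`.

Nothing is cited and nothing is minted: kernel lemmas over the installed definitions (imports
`ThetaHolDirections`, `ThetaHolGerm`, `ThetaGenExports`).
-/
import Summits.HodgeConjecture.HodgeCM.Model.ThetaHolDirections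
import Summits.HodgeConjecture.HodgeCM.Model.ThetaHolGerm
import Summits.HodgeConjecture.HodgeCM.Model.ThetaGenExports

/-! PORT of `HodgeCM/Model/Binders/ArchKTypeHolType.lean` (HodgeCMPerL run 82) — verbatim mechanical port; provenance in the PORT header line. -/

set_option autoImplicit false

noncomputable section

open Filter Topology
open scoped Classical SchwartzMap
open MulAction NumberField.mixedEmbedding
open Literature.Geometry.ComplexHyperbolic.BallModel (U21 Ball x₀)
open Literature.NumberTheory.Automorphic Literature.NumberTheory.Weil1964
open Literature.AlgebraicGeometry.HodgeTheory
open Literature.AlgebraicGeometry.ShimuraVarieties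
open Literature.NumberTheory.Automorphic.PicardCM
open HodgeCM.PerL34.Seesaw HodgeCM.PerL34.RationalCoset HodgeCM.PerL34.SupplyAdelic
open HodgeCM.Model.SupplyInstance HodgeCM.Model.SupplyResidual
open HodgeCM.Model.ThetaSpace

namespace HodgeCM
namespace Model

section PinHolType

variable (hHD : exists_isReal_hodgeModel) (hI : hodgePQ_independent_of_hodgeModel)
  (h₁ : BallQuotientUniformised)  (h₃ : CMAbelianVarietyRealised)

variable {L : CMField} {ι₁ : L →+* ℂ} {V : HermSpace3 L ι₁} {c : SeesawCtx L}

/-- **Holomorphic germs of the adelic theta form of the one family, at every adelic base point** ((H1) + (AN) +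
(REP′)): for an archimedean `K`-type datum `B` over the pinned theta-space input, `B.toProduct.thetaFormOf f` has
holomorphic germs along `ιinf B.Γ₀` — the `key` of `ArchKTypeData.hol_of_isWeaklyCR`, read as `IsHolGerm`. -/
theorem ArchKTypeData.isHolGerm_thetaFormOf_of_isWeaklyCR (S : ThetaAdelicSide V c) (h : IsAnisotropic L V.Hm)
    {k : Fin 4} {N : ℕ} (B : ArchKTypeData (thetaSpaceInputIn hHD hI h₁ h₃ S h) k N)
    (hT : ((thetaSpaceInputIn hHD hI h₁ h₃ S h).P k).IsThetaArchContinuous N)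
    (hd : B.IsWeaklyPDiff BallForms.expP) (hCR : B.IsWeaklyCR BallForms.expP)
    (f : C(relNormOneIdeles (NumberField.maximalRealSubfield L) L ⧸
      relNormOneRat (NumberField.maximalRealSubfield L) L, ℂ)) :
    IsHolGerm ((thetaSpaceInputIn hHD hI h₁ h₃ S h).ιinf B.Γ₀) (B.toProduct.thetaFunIn f) := by
  refine ⟨fun y => ?_, fun y v => ?_⟩
  · exact (ThetaHolAssembly.differentiableAt_and_fderiv_I_smul_pi
      (Fv := fun b : Fin 2 → ℂ =>
        B.toProduct.thetaFunIn f (y * (thetaSpaceInputIn hHD hI h₁ h₃ S h).ιinf B.Γ₀ (BallForms.expP b)))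
      (fun j => (B.differentiableAt_apply_thetaFormOf BallForms.expP hT hd hCR f y (LinearMap.proj j)).1)
      (fun j v => (B.differentiableAt_apply_thetaFormOf BallForms.expP hT hd hCR f y (LinearMap.proj j)).2 v)).1
  · exact (ThetaHolAssembly.differentiableAt_and_fderiv_I_smul_pi
      (Fv := fun b : Fin 2 → ℂ =>
        B.toProduct.thetaFunIn f (y * (thetaSpaceInputIn hHD hI h₁ h₃ S h).ιinf B.Γ₀ (BallForms.expP b)))
      (fun j => (B.differentiableAt_apply_thetaFormOf BallForms.expP hT hd hCR f y (LinearMap.proj j)).1)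
      (fun j v => (B.differentiableAt_apply_thetaFormOf BallForms.expP hT hd hCR f y (LinearMap.proj j)).2 v)).2 v

/-- **`IsHolType` of the product situation, at every `k`** ((H1) + (AN) + (REP′)): every adelic theta form of
`B.toProduct.situation` with weight function in ANY `𝓕` has holomorphic germs along `ιinf B.Γ₀`
(`isHolType_of_generators`: the situation has the one family `jFam`, whose generating theta forms are the
`B.toProduct.thetaFormOf f`, `rfl`). -/
theorem ArchKTypeData.isHolType_of_isWeaklyCR (S : ThetaAdelicSide V c) (h : IsAnisotropic L V.Hm)
    {k : Fin 4} {N : ℕ} (B : ArchKTypeData (thetaSpaceInputIn hHD hI h₁ h₃ S h) k N)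
    (hT : ((thetaSpaceInputIn hHD hI h₁ h₃ S h).P k).IsThetaArchContinuous N)
    (hd : B.IsWeaklyPDiff BallForms.expP) (hCR : B.IsWeaklyCR BallForms.expP)
    (𝓕 : Set C(relNormOneIdeles (NumberField.maximalRealSubfield L) L ⧸
      relNormOneRat (NumberField.maximalRealSubfield L) L, ℂ)) :
    IsHolType hHD hI h₁ h₃ S h B.Γ₀ k B.toProduct.situation 𝓕 := by
  refine isHolType_of_generators hHD hI h₁ h₃ S h B.Γ₀ k B.toProduct.situation 𝓕 fun j hj f _ => ?_
  rw [ProductKTypeData.situation_𝓙, Set.mem_singleton_iff] at hj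
  subst hj
  exact B.isHolGerm_thetaFormOf_of_isWeaklyCR hHD hI h₁ h₃ S h hT hd hCR f

/-- **`adm₃₄` of the product situation, at every `k`** ((Θ-sat) + (SS-K) + (H1)/(AN)/(REP′)): saturated at
`K_{Γ₀}` (`situation_isSaturated`), strict (`situation_isStrict`), of holomorphic type (`isHolType_of_isWeaklyCR`). -/
theorem ArchKTypeData.adm₃₄_of_isWeaklyCR (S : ThetaAdelicSide V c) (h : IsAnisotropic L V.Hm)
    {k : Fin 4} {N : ℕ} (B : ArchKTypeData (thetaSpaceInputIn hHD hI h₁ h₃ S h) k N)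
    (hT : ((thetaSpaceInputIn hHD hI h₁ h₃ S h).P k).IsThetaArchContinuous N)
    (hd : B.IsWeaklyPDiff BallForms.expP) (hCR : B.IsWeaklyCR BallForms.expP) :
    adm₃₄ hHD hI h₁ h₃ S h B.Γ₀ k B.toProduct.situation :=
  ⟨B.toProduct.situation_isSaturated, B.toProduct.situation_isStrict,
    B.isHolType_of_isWeaklyCR hHD hI h₁ h₃ S h hT hd hCR _⟩

/-- **`adm₃₄` of the product situation — `𝔭₋` shape** ((H1) + (AN) + (REP)). -/
theorem ArchKTypeData.adm₃₄_of_isPMinusKilled (S : ThetaAdelicSide V c) (h : IsAnisotropic L V.Hm)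
    {k : Fin 4} {N : ℕ} (B : ArchKTypeData (thetaSpaceInputIn hHD hI h₁ h₃ S h) k N)
    (hT : ((thetaSpaceInputIn hHD hI h₁ h₃ S h).P k).IsThetaArchContinuous N)
    (hd : B.IsWeaklyPDiff BallForms.expP) (hk : B.IsPMinusKilled BallForms.expP) :
    adm₃₄ hHD hI h₁ h₃ S h B.Γ₀ k B.toProduct.situation :=
  B.adm₃₄_of_isWeaklyCR hHD hI h₁ h₃ S h hT hd (B.isWeaklyCR_of_isPMinusKilled BallForms.expP_zero hd hk)

/-- **`adm₃₄` of the product situation — (REP) along the coordinate directions `-i e_0`, `-i e_1` only**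
(the exact shape of E's rows `hpd` / `hk`, now at every `k`). -/
theorem ArchKTypeData.adm₃₄_of_isPMinusKilledAlong (S : ThetaAdelicSide V c) (h : IsAnisotropic L V.Hm)
    {k : Fin 4} {N : ℕ} (B : ArchKTypeData (thetaSpaceInputIn hHD hI h₁ h₃ S h) k N)
    (hT : ((thetaSpaceInputIn hHD hI h₁ h₃ S h).P k).IsThetaArchContinuous N)
    (hd : B.IsWeaklyPDiff BallForms.expP)
    (hk : ∀ p : Fin 2, B.IsPMinusKilledAlong BallForms.expP (-Complex.I • (Pi.single p 1 : Fin 2 → ℂ))) :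
    adm₃₄ hHD hI h₁ h₃ S h B.Γ₀ k B.toProduct.situation :=
  B.adm₃₄_of_isWeaklyCR hHD hI h₁ h₃ S h hT hd
    (B.isWeaklyCR_of_isPMinusKilledAlong BallForms.expP_zero hd (fun _ => -Complex.I) (fun _ => by simp) hk)

/-- **The frame equation of the one family** (`rfl`): the frame `a ↦ Φfam (proj a) = Φ_∞(e_a^∨) ⊗ 1_{x₀ + N𝒪̂}`
maps under `toThetaTop` to the family `jFam` of `B.toProduct.situation` read at `Sit.ι (proj a)` (`Sit.ι = id`). -/
theorem ArchKTypeData.toThetaTop_frame (S : ThetaAdelicSide V c) (h : IsAnisotropic L V.Hm)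
    {k : Fin 4} {N : ℕ} (B : ArchKTypeData (thetaSpaceInputIn hHD hI h₁ h₃ S h) k N)
    (a : Fin 2) :
    ((thetaSpaceInputIn hHD hI h₁ h₃ S h).P k).weilDatum.toThetaTop (B.toProduct.Φfam (LinearMap.proj a)) =
      (⟨B.toProduct.jFam, B.toProduct.isThetaEquivariant_family⟩ :
          {j : B.toProduct.situation.E →ₗ[ℂ] ((thetaSpaceInputIn hHD hI h₁ h₃ S h).P k).weilDatum.ThetaTop //
            ((thetaSpaceInputIn hHD hI h₁ h₃ S h).P k).kernelDatum.IsThetaEquivariant B.toProduct.situation.κ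
              B.toProduct.situation.σ j}).1
        (B.toProduct.situation.ι (LinearMap.proj a)) :=
  rfl

/-- **The packaged admissible frame of an archimedean `K`-type datum** ((H1) + (AN) + (REP) along `-i e_p`): the
situation `B.toProduct.situation` at level `B.Γ₀`, its one family, and the frame `a ↦ B.toProduct.Φfam (proj a)` —
the per-line input of `Binders.Real34WedgeSpan.wedge_mem_admWedgeSpan` (take it at `k = 2` and `k = 3` at a common
level). -/
theorem ArchKTypeData.exists_adm₃₄_frame_of_isPMinusKilledAlong (S : ThetaAdelicSide V c)
    (h : IsAnisotropic L V.Hm) {k : Fin 4} {N : ℕ}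
    (B : ArchKTypeData (thetaSpaceInputIn hHD hI h₁ h₃ S h) k N)
    (hT : ((thetaSpaceInputIn hHD hI h₁ h₃ S h).P k).IsThetaArchContinuous N)
    (hd : B.IsWeaklyPDiff BallForms.expP)
    (hk : ∀ p : Fin 2, B.IsPMinusKilledAlong BallForms.expP (-Complex.I • (Pi.single p 1 : Fin 2 → ℂ))) :
    ∃ (Sit : KTypeSituation ((thetaSpaceInputIn hHD hI h₁ h₃ S h).P k)
        ((thetaSpaceInputIn hHD hI h₁ h₃ S h).ιinf B.Γ₀) ((thetaSpaceInputIn hHD hI h₁ h₃ S h).Δ B.Γ₀)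
        (thetaSpaceInputIn hHD hI h₁ h₃ S h).κ₁ (thetaSpaceInputIn hHD hI h₁ h₃ S h).τ₁)
      (j : {j : Sit.E →ₗ[ℂ] ((thetaSpaceInputIn hHD hI h₁ h₃ S h).P k).weilDatum.ThetaTop //
        ((thetaSpaceInputIn hHD hI h₁ h₃ S h).P k).kernelDatum.IsThetaEquivariant Sit.κ Sit.σ j}),
      (adm₃₄ hHD hI h₁ h₃ S h B.Γ₀ k Sit ∧ j ∈ Sit.𝓙) ∧
        ∀ a : Fin 2, ((thetaSpaceInputIn hHD hI h₁ h₃ S h).P k).weilDatum.toThetaTop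
            (B.toProduct.Φfam (LinearMap.proj a)) = j.1 (Sit.ι (LinearMap.proj a)) :=
  ⟨B.toProduct.situation, ⟨B.toProduct.jFam, B.toProduct.isThetaEquivariant_family⟩,
    ⟨B.adm₃₄_of_isPMinusKilledAlong hHD hI h₁ h₃ S h hT hd hk, by
      rw [ProductKTypeData.situation_𝓙, Set.mem_singleton_iff]⟩,
    fun a => B.toThetaTop_frame hHD hI h₁ h₃ S h a⟩

end PinHolType

end Model
end HodgeCM

end
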